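import Summits.BirchSwinnertonDyer.BirchSwinnertonDyer.Theorems.ManinLocalTwoThreeThreeTorsionIntegralAtThree
import Summits.BirchSwinnertonDyer.BirchSwinnertonDyer.Theorems.ManinLocalTwoThreeFormalXMulSqCoeffNine
import Mathlib.FieldTheory.Finite.Basic
import HarnessLib

/-!
# The `z⁹` blindness certificate: a `3`-BLIND rational `3`-torsion point satisfies `Y₁ ≡ 4(α/3)³ (mod 9)`

Summit `BirchSwinnertonDyer`, route `ManinLocalTwoThree` (cell bsd-f2-manin), crux C3 `ManinPrimeToThreeAtNine` (stmt-BirchSwinnertonDyer-22968),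
stubs NB₃ / (BL).  The NECESSITY HALF of the lead's conjectured congruence law (BL♯) (HOME/p1/BL-scan-memo-p1-g5.md, closed form
«λ(T) = 3 ⟺ [v₃α = 1 ∧ Y₁ ≡ 4(α/3)³ (9)] ∨ [v₃α ≥ 2 ∧ v₃Y₁ = 2]», 62 522 / 62 522): with `s = α/3 ∈ ℤ₃` (tree: `3 ∣ α`), a blind
`T♮ = (X₁, Y₁)` has `Θ♮_T = U³`, `U = −1 + u₁z + u₂z² + u₃z³ + ⋯ ∈ ℤ₃⟦z⟧` (unit-cube criterion); comparing coefficients,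
`u₁ = −s`, `u₂ = s²`, `3u₃ = 3sX₁ − Y₁ − 5s³` (degrees 1–3), and in degree 9 — where `Θ♮` has coefficient `α·a₄♮² ≡ 0 (mod 3)`
(`coeff_kummerCube_generic_four_to_nine`) and `U³ ≡ Σ uᵢ³ z³ⁱ (mod 3)` (Frobenius) — `u₃ ≡ 0 (mod 3)`.  With `X₁ = 3s²` (`α² = 3X₁`)
this is `Y₁ ≡ −5s³ ≡ 4s³ (mod 9)`:

* `toZMod_coeff_nine_cube` — `[z⁹] U³ ≡ [z³] U (mod 3)` for `U ∈ ℤ₃⟦z⟧` (truncate, `ZMod.expand_card`);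
* `threeBlind_congruence_mod_nine` / `…_of_nine_dvd` — **blind ⟹ `9 ∣ Y₁ − 4(α/3)³` in `ℤ₃`** (no point hypotheses at a datum `9 ∣ N`);
* `not_threeBlind_of_not_congruence_mod_nine_of_nine_dvd` — the `z⁹` certificate of NON-blindness (census: together with the `z³`
  certificate it detects 23 578 / 23 578 optimal points and 3 780 / 3 780 local test curves with λ = 1).

Nothing about BSD, Manin's conjecture or C3 is proved. [cite: SilvermanAEC2009, IV.1]
-/

set_option autoImplicit false
set_option linter.dupNamespace false

noncomputable section

open scoped Classical
open PowerSeries WeierstrassCurve Literature.NumberTheory.EllipticCurves Literature.NumberTheory.EllipticCurves.ModularForms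
open Summit.BirchSwinnertonDyer.Rank1Residual.ManinAdditive
open Summit.BirchSwinnertonDyer.Rank1Residual.ManinAdditive.CuspidalKummer
open Summit.BirchSwinnertonDyer.Rank1Residual.ManinAdditive.CuspidalKummerThree

namespace Summit.BirchSwinnertonDyer.BirchSwinnertonDyer.Theorems.ManinLocalTwoThree

/-! ### §1 Low coefficients of a cube and the Frobenius congruence in degree `9` -/

/-- `[tⁿ](f·g) = Σ_{k ≤ n} [tᵏ]f · [tⁿ⁻ᵏ]g`. [folklore] -/
private theorem coeff_mul_sum_range₉ {R : Type*} [CommRing R] (f g : R⟦X⟧) (n : ℕ) :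
    coeff n (f * g) = ∑ k ∈ Finset.range (n + 1), coeff k f * coeff (n - k) g := by
  rw [coeff_mul, Finset.Nat.sum_antidiagonal_eq_sum_range_succ_mk]

/-- The coefficients `t¹, t², t³` of a cube `H³` with `H(0) = −1`. [folklore] -/
private theorem coeff_cube_le_three_of_neg_one {R : Type*} [CommRing R] (H : R⟦X⟧) (h0 : coeff 0 H = -1) :
    coeff 1 (H ^ 3) = 3 * coeff 1 H ∧
    coeff 2 (H ^ 3) = 3 * coeff 2 H - 3 * coeff 1 H ^ 2 ∧
    coeff 3 (H ^ 3) = 3 * coeff 3 H - 6 * coeff 1 H * coeff 2 H + coeff 1 H ^ 3 := by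
  have h3 : H ^ 3 = H * (H * H) := by ring
  refine ⟨?_, ?_, ?_⟩ <;>
  · rw [h3]
    simp only [coeff_mul_sum_range₉, Finset.sum_range_succ, Finset.sum_range_zero, zero_add, Nat.sub_self,
      Nat.reduceSub, Nat.sub_zero, h0]
    ring

/-- **Frobenius in degree `9`**: for `U ∈ ℤ₃⟦z⟧`, `[z⁹](U³) ≡ [z³]U (mod 3)` — in `𝔽₃⟦z⟧`, `Ū³ = Σ ūᵢ z³ⁱ`. [folklore] -/
theorem toZMod_coeff_nine_cube (U : (ℤ_[3])⟦X⟧) :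
    PadicInt.toZMod (p := 3) (coeff 9 (U ^ 3)) = PadicInt.toZMod (p := 3) (coeff 3 U) := by
  set T : Polynomial ℤ_[3] := PowerSeries.trunc 10 U with hT
  have hdiv : (X : (ℤ_[3])⟦X⟧) ^ 10 ∣ U - (T : (ℤ_[3])⟦X⟧) := by
    rw [PowerSeries.X_pow_dvd_iff]
    intro m hm
    rw [map_sub, Polynomial.coeff_coe, hT, coeff_trunc, if_pos hm, sub_self]
  have hdiv3 : (X : (ℤ_[3])⟦X⟧) ^ 10 ∣ U ^ 3 - (T : (ℤ_[3])⟦X⟧) ^ 3 := by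
    have e : U ^ 3 - (T : (ℤ_[3])⟦X⟧) ^ 3 = (U - T) * (U ^ 2 + U * T + (T : (ℤ_[3])⟦X⟧) ^ 2) := by ring
    rw [e]; exact Dvd.dvd.mul_right hdiv _
  have h9 : coeff 9 (U ^ 3) = coeff 9 ((T : (ℤ_[3])⟦X⟧) ^ 3) := by
    have := (PowerSeries.X_pow_dvd_iff.mp hdiv3) 9 (by norm_num)
    rwa [map_sub, sub_eq_zero] at this
  rw [h9, ← Polynomial.coe_pow, Polynomial.coeff_coe, ← Polynomial.coeff_map, Polynomial.map_pow, ← ZMod.expand_card,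
    Polynomial.coeff_expand (by norm_num)]
  rw [if_pos (by norm_num : (3 ∣ 9)), show 9 / 3 = 3 from rfl, Polynomial.coeff_map, hT, coeff_trunc, if_pos (by norm_num)]

/-! ### §2 The `z⁹` congruence -/

/-- **The `z⁹` blindness certificate (necessity half of (BL♯)).**  With `3`-integral `a₄♮, a₆♮` and `T = (X₁, Y₁)` of order `3`
on `E♮`: if `T` is `3`-blind then `Y₁ ≡ 4(α/3)³ (mod 9)`, i.e. `(Y₁ − 4(α/3)³)/9` is `3`-integral. [cite: SilvermanAEC2009, IV.1] -/
theorem threeBlind_congruence_mod_nine (W : WeierstrassCurve ℚ)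
    (hA : ‖(((shortModel W 1).a₄ : ℚ) : ℚ_[3])‖ ≤ 1) (hB : ‖(((shortModel W 1).a₆ : ℚ) : ℚ_[3])‖ ≤ 1)
    {X₁ Y₁ : ℚ} (hT : IsShortThreeTorsion W 1 X₁ Y₁) (hb : ThreeBlind W X₁ Y₁) :
    ‖(((Y₁ - 4 * (tangentSlope W 1 X₁ Y₁ / 3) ^ 3) / 9 : ℚ) : ℚ_[3])‖ ≤ 1 := by
  obtain ⟨hX, hY⟩ := norm_le_one_of_isShortThreeTorsion W hA hB hT
  have hs := norm_tangentSlope_div_three_le_one hT hX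
  have hαn := norm_tangentSlope_le_one hT hX
  set α := tangentSlope W 1 X₁ Y₁ with hαdef
  -- `3`-adic integers
  set A₀ : ℤ_[3] := ⟨_, hA⟩ with hA₀
  set B₀ : ℤ_[3] := ⟨_, hB⟩ with hB₀
  set x : ℤ_[3] := ⟨_, hX⟩ with hxdef
  set y : ℤ_[3] := ⟨_, hY⟩ with hydef
  set a : ℤ_[3] := ⟨_, hαn⟩ with hadef
  set s : ℤ_[3] := ⟨_, hs⟩ with hsdef
  have c3 : ((3 : ℤ_[3]) : ℚ_[3]) = 3 := by exact_mod_cast PadicInt.coe_natCast 3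
  have c4 : ((4 : ℤ_[3]) : ℚ_[3]) = 4 := by exact_mod_cast PadicInt.coe_natCast 4
  have c9 : ((9 : ℤ_[3]) : ℚ_[3]) = 9 := by exact_mod_cast PadicInt.coe_natCast 9
  have has : a = 3 * s := by
    apply Subtype.ext
    show ((α : ℚ) : ℚ_[3]) = ((3 * s : ℤ_[3]) : ℚ_[3])
    rw [PadicInt.coe_mul, c3]; show ((α : ℚ) : ℚ_[3]) = 3 * ((α / 3 : ℚ) : ℚ_[3]); push_cast; ring
  -- `α² = 3X₁` read in `ℤ₃`: `x = 3s²`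
  have hx3 : x = 3 * s ^ 2 := by
    have hflex := tangentSlope_sq_eq_three_mul hT
    rw [← hαdef] at hflex
    apply Subtype.ext
    show ((X₁ : ℚ) : ℚ_[3]) = ((3 * s ^ 2 : ℤ_[3]) : ℚ_[3])
    rw [PadicInt.coe_mul, PadicInt.coe_pow, c3]
    show ((X₁ : ℚ) : ℚ_[3]) = 3 * ((α / 3 : ℚ) : ℚ_[3]) ^ 2
    have : (X₁ : ℚ) = 3 * (α / 3) ^ 2 := by field_simp; linear_combination -hflex
    rw [this]; push_cast; ring
  -- the model `V = E♮` over `ℤ₃` and the integral Kummer series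
  set V : WeierstrassCurve ℤ_[3] := ⟨0, 0, 0, A₀, B₀⟩ with hVdef
  have hV1 : V.a₁ = 0 := rfl
  have hV2 : V.a₂ = 0 := rfl
  have hV3 : V.a₃ = 0 := rfl
  have hrat : ∀ q : ℚ, algebraMap ℚ ℚ_[3] q = (q : ℚ_[3]) := fun q => by rw [eq_ratCast]
  have hVE : V.map PadicInt.Coe.ringHom = (shortModel W 1).map (algebraMap ℚ ℚ_[3]) := by
    ext <;> simp [hVdef, shortModel, hA₀, hB₀, hrat]
  set ΘV : (ℤ_[3])⟦X⟧ := V.formalYMulCube - C y * X ^ 3 - C a * (V.formalXMulSq * X - C x * X ^ 3) with hΘV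
  have hmapΘ : PowerSeries.map (Rat.castHom ℚ_[3]) (kummerCubeSeries W 1 X₁ Y₁ X) =
      PowerSeries.map PadicInt.Coe.ringHom ΘV := by
    rw [Subsingleton.elim (Rat.castHom ℚ_[3]) (algebraMap ℚ ℚ_[3])]
    have hY1 : (shortModel W 1).formalYMulCube = -(shortModel W 1).formalXMulSq := rfl
    have hYV : V.formalYMulCube = -V.formalXMulSq := rfl
    have hXS : PowerSeries.map (algebraMap ℚ ℚ_[3]) (shortModel W 1).formalXMulSq =
        PowerSeries.map PadicInt.Coe.ringHom V.formalXMulSq := by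
      rw [map_formalXMulSq, map_formalXMulSq, hVE]
    rw [kummerCubeSeries, X_subst, X_subst, hY1, hΘV, hYV, ← hαdef]
    simp only [smul_eq_C_mul, map_sub, map_neg, map_mul, map_pow, PowerSeries.map_C, PowerSeries.map_X, hXS, hrat]
    have ex : (PadicInt.Coe.ringHom (p := 3)) x = ((X₁ : ℚ) : ℚ_[3]) := rfl
    have ey : (PadicInt.Coe.ringHom (p := 3)) y = ((Y₁ : ℚ) : ℚ_[3]) := rfl
    have ea : (PadicInt.Coe.ringHom (p := 3)) a = ((α : ℚ) : ℚ_[3]) := rfl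
    rw [ex, ey, ea]
  -- coefficients of `ΘV`
  obtain ⟨θ0, θ1, θ2, θ3⟩ := coeff_kummerCube_generic_le_three V hV1 hV2 hV3 x y a
  obtain ⟨-, -, -, -, -, θ9⟩ := coeff_kummerCube_generic_four_to_nine V hV1 hV2 hV3 x y a
  -- the unit cube
  have h0u : IsUnit (constantCoeff ΘV) := by
    rw [← coeff_zero_eq_constantCoeff_apply, θ0]; exact isUnit_one.neg
  obtain ⟨U, -, hU⟩ := (threeBlind_iff_exists_isUnit_cube W X₁ Y₁ ΘV hmapΘ.symm h0u).mp hb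
  -- compare coefficients
  have hU0 : coeff 0 U = -1 := by
    apply eq_neg_one_of_pow_three_eq_neg_one
    have h := congrArg (coeff 0) hU
    rw [coeff_zero_eq_constantCoeff_apply, coeff_zero_eq_constantCoeff_apply, map_pow] at h
    rw [coeff_zero_eq_constantCoeff_apply, ← h, ← coeff_zero_eq_constantCoeff_apply, θ0]
  obtain ⟨e1, e2, e3⟩ := coeff_cube_le_three_of_neg_one U hU0
  have q1 : coeff 1 ΘV = coeff 1 (U ^ 3) := by rw [hU]
  have q2 : coeff 2 ΘV = coeff 2 (U ^ 3) := by rw [hU]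
  have q3 : coeff 3 ΘV = coeff 3 (U ^ 3) := by rw [hU]
  have q9 : coeff 9 ΘV = coeff 9 (U ^ 3) := by rw [hU]
  rw [θ1, e1] at q1
  rw [θ2, e2] at q2
  rw [θ3, e3] at q3
  rw [θ9] at q9
  have h3ne : (3 : ℤ_[3]) ≠ 0 := by
    have := (PadicInt.irreducible_p (p := 3)).ne_zero; exact_mod_cast this
  -- `u₁ = −s`, `u₂ = s²`
  have hu1 : coeff 1 U = -s := by
    have : (3 : ℤ_[3]) * coeff 1 U = 3 * (-s) := by rw [← q1, has]; ring
    exact mul_left_cancel₀ h3ne this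
  have hu2 : coeff 2 U = s ^ 2 := by
    have h := q2
    rw [hu1] at h
    have : (3 : ℤ_[3]) * coeff 2 U = 3 * s ^ 2 := by linear_combination -h
    exact mul_left_cancel₀ h3ne this
  -- degree `9` modulo `3`: `u₃ ≡ 0`
  have hu3 : (3 : ℤ_[3]) ∣ coeff 3 U := by
    have hfrob := toZMod_coeff_nine_cube U
    rw [← q9, has] at hfrob
    have hz : PadicInt.toZMod (p := 3) (3 * s * V.a₄ ^ 2) = 0 := by
      rw [map_mul, map_mul, show PadicInt.toZMod (p := 3) 3 = 0 from ?_, zero_mul, zero_mul]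
      have : ((3 : ℕ) : ℤ_[3]) ∈ RingHom.ker (PadicInt.toZMod (p := 3)) := by
        rw [PadicInt.ker_toZMod, PadicInt.maximalIdeal_eq_span_p]; exact Ideal.mem_span_singleton_self _
      simpa using this
    rw [hz] at hfrob
    have hker : coeff 3 U ∈ RingHom.ker (PadicInt.toZMod (p := 3)) := hfrob.symm
    rw [PadicInt.ker_toZMod, PadicInt.maximalIdeal_eq_span_p, Ideal.mem_span_singleton] at hker
    exact_mod_cast hker
  obtain ⟨t, ht⟩ := hu3
  -- degree `3`: `3u₃ − 6u₁u₂ + u₁³ = a x − y`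
  have hy : y = 4 * s ^ 3 - 9 * t := by
    have h := q3
    rw [hu1, hu2, ht, has, hx3] at h
    linear_combination -h
  -- back to `ℚ`
  have key : (((Y₁ - 4 * (α / 3) ^ 3) / 9 : ℚ) : ℚ_[3]) = ((-t : ℤ_[3]) : ℚ_[3]) := by
    have eY : ((Y₁ : ℚ) : ℚ_[3]) = ((y : ℤ_[3]) : ℚ_[3]) := rfl
    have eS : ((α / 3 : ℚ) : ℚ_[3]) = ((s : ℤ_[3]) : ℚ_[3]) := rfl
    have h9 : (9 : ℚ_[3]) ≠ 0 := by norm_num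
    have eQ : (((Y₁ - 4 * (α / 3) ^ 3) / 9 : ℚ) : ℚ_[3]) = (((Y₁ : ℚ) : ℚ_[3]) - 4 * ((α / 3 : ℚ) : ℚ_[3]) ^ 3) / 9 := by
      push_cast; ring
    rw [eQ, eY, eS, hy]
    push_cast
    simp only [c4, c9]
    field_simp
    ring
  rw [key]
  exact PadicInt.norm_le_one _

/-- **The `z⁹` congruence at a datum of level `9 ∣ N`** (no hypotheses on the point). [cite: SilvermanAEC2009, IV.1] -/
theorem threeBlind_congruence_mod_nine_of_nine_dvd (W : WeierstrassCurve ℚ) [W.IsElliptic] [W.IsGloballyMinimal]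
    {N : ℕ} [NeZero N] (D : ModularParametrizationData W N) (h9 : 9 ∣ N) {X₁ Y₁ : ℚ} (hT : IsShortThreeTorsion W 1 X₁ Y₁)
    (hb : ThreeBlind W X₁ Y₁) : ‖(((Y₁ - 4 * (tangentSlope W 1 X₁ Y₁ / 3) ^ 3) / 9 : ℚ) : ℚ_[3])‖ ≤ 1 := by
  obtain ⟨hA, hB⟩ := norm_shortModel_le_one_of_nine_dvd W D h9
  exact threeBlind_congruence_mod_nine W hA hB hT hb

/-- **`z⁹` certificate of NON-blindness**: at a datum of level `9 ∣ N`, a rational point `T` of order `3` of `E♮` with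
`Y₁ ≢ 4(α/3)³ (mod 9)` is not `3`-blind. [cite: SilvermanAEC2009, IV.1] -/
theorem not_threeBlind_of_not_congruence_mod_nine_of_nine_dvd (W : WeierstrassCurve ℚ) [W.IsElliptic] [W.IsGloballyMinimal]
    {N : ℕ} [NeZero N] (D : ModularParametrizationData W N) (h9 : 9 ∣ N) {X₁ Y₁ : ℚ} (hT : IsShortThreeTorsion W 1 X₁ Y₁)
    (hcert : 1 < ‖(((Y₁ - 4 * (tangentSlope W 1 X₁ Y₁ / 3) ^ 3) / 9 : ℚ) : ℚ_[3])‖) : ¬ ThreeBlind W X₁ Y₁ := fun hb =>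
  absurd (threeBlind_congruence_mod_nine_of_nine_dvd W D h9 hT hb) (not_le.mpr hcert)

end Summit.BirchSwinnertonDyer.BirchSwinnertonDyer.Theorems.ManinLocalTwoThree

end
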